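import Summits.Ventures.PercRepro.C025ProfileGirthRowsAll

/-!
# THE DISJOINTNESS LEMMA FOR INDEPENDENT SETS (night-3 g21)

For every finite matroid `N` and every family `ℬ` of independent sets, the independent sets DISJOINT from some
member of `ℬ` are at least as many as the members of `ℬ`:
  `#ℬ ≤ #{T ⊆ E : N.Indep T ∧ ∃ B ∈ ℬ, T ∩ B = ∅}`.
Proof by induction on `|E|` through deletion and contraction of a point `e`: the candidates without `e` are the
candidates of `N ＼ e` for the family `ℬ₀ ∪ ℬ₁` (`ℬ₀` = members avoiding `e`, `ℬ₁` = members through `e` with `e`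
erased), the candidates through `e` are `e` plus the candidates of `N ／ e` for the family `ℬ₀′ = {B ∈ ℬ₀ : B ∪ e
independent}`, and `#(ℬ₀ ∪ ℬ₁) + #ℬ₀′ ≥ #ℬ₀ + #ℬ₁ = #ℬ` because `ℬ₀ ∩ ℬ₁ ⊆ ℬ₀′`.  (Applied to the dual matroid
in the companion module it gives the Hall form of the top row `(q, ρ(E))` of (Π) on every finite matroid.)
* `gr_delete_singleton`, `gr_contract_singleton` — the ground sets of `N ＼ {e}` and `N ／ {e}` as Finsets;
* **`card_le_card_indep_disjoint (N) [N.Finite] (ℬ) (hℬ : ∀ B ∈ ℬ, N.Indep B) : #ℬ ≤ #{T : indep, disjoint from some B ∈ ℬ}`**.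
No `def`, no `instance`, no notation.  Axioms: standard.
-/

open scoped Matroid

namespace PercRepro

open Set Finset ThmH

namespace TopHall

variable {α : Type} [DecidableEq α]

/-- The ground Finset of `N ＼ {e}`. -/
theorem gr_delete_singleton (N : Matroid α) [N.Finite] (e : α) :
    gr (N ＼ ({e} : Set α)) = (gr N).erase e := by
  apply Finset.coe_injective
  rw [coe_gr, Finset.coe_erase, coe_gr, Matroid.delete_ground]

/-- The ground Finset of `N ／ {e}`. -/
theorem gr_contract_singleton (N : Matroid α) [N.Finite] (e : α) :
    gr (N ／ ({e} : Set α)) = (gr N).erase e := by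
  apply Finset.coe_injective
  rw [coe_gr, Finset.coe_erase, coe_gr, Matroid.contract_ground]

omit [DecidableEq α] in
/-- Membership in the ground Finset. -/
theorem mem_gr_iff (N : Matroid α) [N.Finite] (x : α) : x ∈ gr N ↔ x ∈ N.E := by
  rw [← Finset.mem_coe, coe_gr]

open scoped Classical in
/-- **The disjointness lemma**, in the form used for the induction on the size of the ground set: for every finite
matroid `N` on `n` points and every family `ℬ` of independent sets, `#ℬ ≤ #{T independent : T disjoint from some
member of ℬ}`. -/
theorem card_le_card_indep_disjoint_aux (n : ℕ) : ∀ (N : Matroid α) [N.Finite], (gr N).card = n →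
    ∀ ℬ : Finset (Finset α), (∀ B ∈ ℬ, N.Indep (B : Set α)) →
      ℬ.card ≤ ((gr N).powerset.filter
        (fun T : Finset α => N.Indep (T : Set α) ∧ ∃ B ∈ ℬ, Disjoint T B)).card := by
  induction n with
  | zero =>
    intro N _ hn ℬ hℬ
    rw [Finset.card_eq_zero] at hn
    -- every member of ℬ is empty
    have hsub : ℬ ⊆ {∅} := by
      intro B hB
      rw [Finset.mem_singleton]
      have h1 : (B : Set α) ⊆ N.E := (hℬ B hB).subset_ground
      rw [← coe_gr, hn, Finset.coe_empty, Set.subset_empty_iff, Finset.coe_eq_empty] at h1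
      exact h1
    rcases Finset.eq_empty_or_nonempty ℬ with hempty | hne
    · rw [hempty, Finset.card_empty]
      exact Nat.zero_le _
    · have h1 : ℬ.card ≤ 1 := by
        calc ℬ.card ≤ ({∅} : Finset (Finset α)).card := Finset.card_le_card hsub
          _ = 1 := Finset.card_singleton _
      have h2 : ∅ ∈ ℬ := by
        obtain ⟨B, hB⟩ := hne.exists_mem
        have := hsub hB
        rw [Finset.mem_singleton] at this
        rw [← this]
        exact hB
      have h3 : (∅ : Finset α) ∈ (gr N).powerset.filter
          (fun T : Finset α => N.Indep (T : Set α) ∧ ∃ B ∈ ℬ, Disjoint T B) := by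
        rw [Finset.mem_filter, Finset.mem_powerset]
        exact ⟨Finset.empty_subset _, by rw [Finset.coe_empty]; exact N.empty_indep,
          ∅, h2, Finset.disjoint_empty_left _⟩
      exact h1.trans (Finset.card_pos.2 ⟨∅, h3⟩)
  | succ n ih =>
    intro N _ hn ℬ hℬ
    -- pick a point e of the ground set
    have hne : (gr N).Nonempty := by
      rw [← Finset.card_pos, hn]
      exact Nat.succ_pos n
    obtain ⟨e, he⟩ := hne.exists_mem
    have heE : e ∈ N.E := (mem_gr_iff N e).1 he
    -- the deletion N ＼ e
    have hgr1 : gr (N ＼ ({e} : Set α)) = (gr N).erase e := gr_delete_singleton N e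
    have hcard1 : (gr (N ＼ ({e} : Set α))).card = n := by
      rw [hgr1, Finset.card_erase_of_mem he, hn]
      rfl
    -- candidates of N ＼ e lie among the candidates of N (for a family whose members refine ℬ)
    have hmono : ∀ (ℬ' : Finset (Finset α)),
        (∀ B' ∈ ℬ', ∃ B ∈ ℬ, B' ⊆ B ∧ ∀ x ∈ B, x ≠ e → x ∈ B') →
        ((gr (N ＼ ({e} : Set α))).powerset.filter
          (fun T : Finset α => (N ＼ ({e} : Set α)).Indep (T : Set α) ∧ ∃ B ∈ ℬ', Disjoint T B)) ⊆
        (gr N).powerset.filter (fun T : Finset α => N.Indep (T : Set α) ∧ ∃ B ∈ ℬ, Disjoint T B) := by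
      intro ℬ' hℬ' T hT
      rw [Finset.mem_filter, Finset.mem_powerset, hgr1] at hT
      obtain ⟨hTg, hTi, B', hB', hdisj⟩ := hT
      rw [Finset.mem_filter, Finset.mem_powerset]
      refine ⟨hTg.trans (Finset.erase_subset e _), (Matroid.delete_indep_iff.1 hTi).1, ?_⟩
      obtain ⟨B, hB, hB'B, hBB'⟩ := hℬ' B' hB'
      refine ⟨B, hB, ?_⟩
      rw [Finset.disjoint_left]
      intro x hxT hxB
      have hxe : x ≠ e := by
        intro hxe
        rw [hxe] at hxT
        exact (Finset.mem_erase.1 (hTg hxT)).1 rfl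
      exact (Finset.disjoint_left.1 hdisj) hxT (hBB' x hxB hxe)
    by_cases hloop : N.Indep ({e} : Set α)
    · -- e is not a loop: split ℬ by e
      set ℬ₀ := ℬ.filter (fun B : Finset α => e ∉ B) with hℬ₀
      set ℬ₁ := (ℬ.filter (fun B : Finset α => e ∈ B)).image (fun B : Finset α => B.erase e) with hℬ₁
      set ℬ₀' := ℬ₀.filter (fun B : Finset α => N.Indep ((insert e B : Finset α) : Set α)) with hℬ₀'
      -- the contraction N ／ e
      have hgr2 : gr (N ／ ({e} : Set α)) = (gr N).erase e := gr_contract_singleton N e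
      have hcard2 : (gr (N ／ ({e} : Set α))).card = n := by
        rw [hgr2, Finset.card_erase_of_mem he, hn]
        rfl
      -- members of ℬ₀ ∪ ℬ₁ are independent in N ＼ e
      have hind1 : ∀ B ∈ ℬ₀ ∪ ℬ₁, (N ＼ ({e} : Set α)).Indep (B : Set α) := by
        intro B hB
        rw [Matroid.delete_indep_iff, Set.disjoint_singleton_right, Finset.mem_coe]
        rw [Finset.mem_union] at hB
        rcases hB with hB | hB
        · rw [hℬ₀, Finset.mem_filter] at hB
          exact ⟨hℬ B hB.1, hB.2⟩
        · rw [hℬ₁, Finset.mem_image] at hB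
          obtain ⟨B', hB', rfl⟩ := hB
          rw [Finset.mem_filter] at hB'
          refine ⟨(hℬ B' hB'.1).subset ?_, Finset.notMem_erase e B'⟩
          rw [Finset.coe_erase]
          exact Set.sdiff_subset
      -- members of ℬ₀' are independent in N ／ e
      have hind2 : ∀ B ∈ ℬ₀', (N ／ ({e} : Set α)).Indep (B : Set α) := by
        intro B hB
        rw [hℬ₀', Finset.mem_filter, hℬ₀, Finset.mem_filter] at hB
        rw [hloop.contract_indep_iff, Set.disjoint_singleton_right, Finset.mem_coe, Set.union_singleton,
          ← Finset.coe_insert]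
        exact ⟨hB.1.2, hB.2⟩
      -- the two induction hypotheses
      have ih1 := ih (N ＼ ({e} : Set α)) hcard1 (ℬ₀ ∪ ℬ₁) hind1
      have ih2 := ih (N ／ ({e} : Set α)) hcard2 ℬ₀' hind2
      -- the candidates of N ＼ e for ℬ₀ ∪ ℬ₁ are candidates of N
      have hsub1 := hmono (ℬ₀ ∪ ℬ₁) (by
        intro B' hB'
        rw [Finset.mem_union] at hB'
        rcases hB' with hB' | hB'
        · rw [hℬ₀, Finset.mem_filter] at hB'
          exact ⟨B', hB'.1, subset_refl _, fun x hx _ => hx⟩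
        · rw [hℬ₁, Finset.mem_image] at hB'
          obtain ⟨B, hB, rfl⟩ := hB'
          rw [Finset.mem_filter] at hB
          exact ⟨B, hB.1, Finset.erase_subset e B, fun x hx hxe => Finset.mem_erase.2 ⟨hxe, hx⟩⟩)
      -- the candidates of N ／ e for ℬ₀', with e inserted, are candidates of N
      have hsub2 : ((gr (N ／ ({e} : Set α))).powerset.filter
          (fun T : Finset α => (N ／ ({e} : Set α)).Indep (T : Set α) ∧ ∃ B ∈ ℬ₀', Disjoint T B)).image
            (fun T : Finset α => insert e T) ⊆
          (gr N).powerset.filter (fun T : Finset α => N.Indep (T : Set α) ∧ ∃ B ∈ ℬ, Disjoint T B) := by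
        intro S hS
        rw [Finset.mem_image] at hS
        obtain ⟨T, hT, rfl⟩ := hS
        rw [Finset.mem_filter, Finset.mem_powerset, hgr2] at hT
        obtain ⟨hTg, hTi, B, hB, hdisj⟩ := hT
        rw [Finset.mem_filter, Finset.mem_powerset]
        refine ⟨Finset.insert_subset he (hTg.trans (Finset.erase_subset e _)), ?_, ?_⟩
        · rw [hloop.contract_indep_iff, Set.union_singleton, ← Finset.coe_insert] at hTi
          exact hTi.2
        · rw [hℬ₀', Finset.mem_filter, hℬ₀, Finset.mem_filter] at hB
          refine ⟨B, hB.1.1, ?_⟩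
          rw [Finset.disjoint_left]
          intro x hxT hxB
          rw [Finset.mem_insert] at hxT
          rcases hxT with rfl | hxT
          · exact hB.1.2 hxB
          · exact (Finset.disjoint_left.1 hdisj) hxT hxB
      -- the two candidate families are disjoint (e ∉ T versus e ∈ T)
      have hdisj12 : Disjoint
          ((gr (N ＼ ({e} : Set α))).powerset.filter
            (fun T : Finset α => (N ＼ ({e} : Set α)).Indep (T : Set α) ∧ ∃ B ∈ ℬ₀ ∪ ℬ₁, Disjoint T B))
          (((gr (N ／ ({e} : Set α))).powerset.filter
            (fun T : Finset α => (N ／ ({e} : Set α)).Indep (T : Set α) ∧ ∃ B ∈ ℬ₀', Disjoint T B)).image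
              (fun T : Finset α => insert e T)) := by
        rw [Finset.disjoint_left]
        intro T hT1 hT2
        rw [Finset.mem_filter, Finset.mem_powerset, hgr1] at hT1
        rw [Finset.mem_image] at hT2
        obtain ⟨T', _, rfl⟩ := hT2
        exact (Finset.mem_erase.1 (hT1.1 (Finset.mem_insert_self e T'))).1 rfl
      -- the insertion of e is injective on sets avoiding e
      have hinj : ((gr (N ／ ({e} : Set α))).powerset.filter
          (fun T : Finset α => (N ／ ({e} : Set α)).Indep (T : Set α) ∧ ∃ B ∈ ℬ₀', Disjoint T B)).card =
          (((gr (N ／ ({e} : Set α))).powerset.filter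
            (fun T : Finset α => (N ／ ({e} : Set α)).Indep (T : Set α) ∧ ∃ B ∈ ℬ₀', Disjoint T B)).image
              (fun T : Finset α => insert e T)).card := by
        rw [Finset.card_image_of_injOn]
        intro T hT T' hT' heq
        rw [Finset.mem_coe, Finset.mem_filter, Finset.mem_powerset, hgr2] at hT hT'
        have h1 : e ∉ T := fun h => (Finset.mem_erase.1 (hT.1 h)).1 rfl
        have h2 : e ∉ T' := fun h => (Finset.mem_erase.1 (hT'.1 h)).1 rfl
        simp only at heq
        rw [← Finset.erase_insert h1, ← Finset.erase_insert h2, heq]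
      -- counting the family: #ℬ = #ℬ₀ + #ℬ₁, #(ℬ₀ ∪ ℬ₁) + #(ℬ₀ ∩ ℬ₁) = #ℬ₀ + #ℬ₁, ℬ₀ ∩ ℬ₁ ⊆ ℬ₀'
      have hc1 : ℬ.card = ℬ₀.card + ℬ₁.card := by
        rw [hℬ₁, Finset.card_image_of_injOn, hℬ₀, add_comm, Finset.card_filter_add_card_filter_not]
        intro B hB B' hB' heq
        rw [Finset.mem_coe, Finset.mem_filter] at hB hB'
        simp only at heq
        rw [← Finset.insert_erase hB.2, ← Finset.insert_erase hB'.2, heq]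
      have hc2 : (ℬ₀ ∪ ℬ₁).card + (ℬ₀ ∩ ℬ₁).card = ℬ₀.card + ℬ₁.card :=
        Finset.card_union_add_card_inter _ _
      have hc3 : ℬ₀ ∩ ℬ₁ ⊆ ℬ₀' := by
        intro B hB
        rw [Finset.mem_inter] at hB
        rw [hℬ₀', Finset.mem_filter]
        refine ⟨hB.1, ?_⟩
        have hB1 := hB.2
        rw [hℬ₁, Finset.mem_image] at hB1
        obtain ⟨B', hB', rfl⟩ := hB1
        rw [Finset.mem_filter] at hB'
        rw [Finset.insert_erase hB'.2]
        exact hℬ B' hB'.1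
      have hc4 : (ℬ₀ ∩ ℬ₁).card ≤ ℬ₀'.card := Finset.card_le_card hc3
      -- assemble
      have hunion : (((gr (N ＼ ({e} : Set α))).powerset.filter
            (fun T : Finset α => (N ＼ ({e} : Set α)).Indep (T : Set α) ∧ ∃ B ∈ ℬ₀ ∪ ℬ₁, Disjoint T B)) ∪
          (((gr (N ／ ({e} : Set α))).powerset.filter
            (fun T : Finset α => (N ／ ({e} : Set α)).Indep (T : Set α) ∧ ∃ B ∈ ℬ₀', Disjoint T B)).image
              (fun T : Finset α => insert e T))).card ≤
          ((gr N).powerset.filter (fun T : Finset α => N.Indep (T : Set α) ∧ ∃ B ∈ ℬ, Disjoint T B)).card :=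
        Finset.card_le_card (Finset.union_subset hsub1 hsub2)
      rw [Finset.card_union_of_disjoint hdisj12, ← hinj] at hunion
      omega
    · -- e is a loop: no member of ℬ contains e and no candidate does; pass to N ＼ e with the same family
      have hnot : ∀ B ∈ ℬ, e ∉ B := by
        intro B hB heB
        apply hloop
        apply (hℬ B hB).subset
        rw [Set.singleton_subset_iff, Finset.mem_coe]
        exact heB
      have hind1 : ∀ B ∈ ℬ, (N ＼ ({e} : Set α)).Indep (B : Set α) := by
        intro B hB
        rw [Matroid.delete_indep_iff, Set.disjoint_singleton_right, Finset.mem_coe]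
        exact ⟨hℬ B hB, hnot B hB⟩
      have ih1 := ih (N ＼ ({e} : Set α)) hcard1 ℬ hind1
      have hsub1 := hmono ℬ (fun B' hB' => ⟨B', hB', subset_refl _, fun x hx _ => hx⟩)
      exact ih1.trans (Finset.card_le_card hsub1)

open scoped Classical in
/-- **THE DISJOINTNESS LEMMA**: for every finite matroid `N` and every family `ℬ` of independent sets, the
independent sets disjoint from some member of `ℬ` are at least as many as the members of `ℬ`. -/
theorem card_le_card_indep_disjoint (N : Matroid α) [N.Finite] (ℬ : Finset (Finset α))
    (hℬ : ∀ B ∈ ℬ, N.Indep (B : Set α)) :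
    ℬ.card ≤ ((gr N).powerset.filter
      (fun T : Finset α => N.Indep (T : Set α) ∧ ∃ B ∈ ℬ, Disjoint T B)).card :=
  card_le_card_indep_disjoint_aux (gr N).card N rfl ℬ hℬ

end TopHall

end PercRepro
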